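import Summits.QuantumFields.YangMills.Theorems.ColdStartUniversalityColdStartSolutionsExistFlatFiltration
import Literature.Probability.Process.ItoIntegralCovariation
import HarnessLib

/-!
# Route `ColdStartUniversality`, rung `stub_fixedCutoffMixing` of K_A1 (stmt-QuantumFields-24809):
# zero cross-variation of the flat Brownian coordinates and the covariation of Itô integrals
# against two coordinates (joint filtration)

Helper file (seat `ym-line-csu-p1`, g6) for the `WilsonMeasureLangevinInvariant` wall of the rung
(`Cruxes/UniformColdStartMixing/Lines/rung_fixedCutoffMixing.md`, step 1 "cross-coordinate Itô
product rule"): the SZZ lattice Langevin system is driven by the `8·|E|` coordinates `W^{e,n}` of ONE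
flat Brownian motion, its solutions are adapted to the JOINT raw natural filtration
`𝓕 = hW.natFiltration`, and every multidimensional Itô / Dynkin formula for it needs the brackets
`⟨∫ H dW^i, ∫ K dW^j⟩ = δ_{ij} ∫ H K dr`.  With the generic covariation theorem
`Literature.Probability.Process.IsItoIntegral.integral_mul_sub_mul_sub` (Revuz–Yor IV Thm (2.2):
`(K·M)N - K·⟨M,N⟩` is a martingale) this reduces to the two coordinate martingale facts
`(W^i)² - t` (tree: `martingale_coord_sq_sub`, `martingale_flatCoord_sq_sub`) and, NEW here,
**`W^i W^j` is an `𝓕`-martingale for `i ≠ j`** (`martingale_coord_mul_coord`,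
`martingale_flatCoord_mul_flatCoord`; from the independence of the increment VECTOR from the joint
past and `E[ΔW^i ΔW^j] = 0`, `gaussVec_integral_mul_of_ne`).  Payoff, for Itô integrals
`J = ∫ H dW^i`, `J' = ∫ K dW^j` of progressive square-integrable integrands w.r.t. the JOINT
filtration, `s ≤ t`, `Z` bounded `𝓕_s`-measurable:

* `integral_itoIntegral_flatCoord_mul_sub_of_ne` — `E[Z (J_t - J_s)(J'_t - J'_s)] = 0` for `i ≠ j`;
* `integral_itoIntegral_flatCoord_mul_sub_self` —
  `E[Z (J_t - J_s)(J'_t - J'_s)] = E[Z ∫_{(s,t]} H K dr]` for `i = j`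

(and the `IsBrownianVec` versions `…coord…`).  No definition, no sorry, standard axioms.
RECORD-rung plumbing (R3); nothing here bears on the Yang–Mills mass gap, which is NOT proved.
-/

set_option autoImplicit false

noncomputable section

namespace Summit.QuantumFields.YangMills.Theorems.ColdStartUniversality

open MeasureTheory ProbabilityTheory Filter
open scoped NNReal ENNReal
open Literature.Probability.Process Literature.MathematicalPhysics.QuantumFieldTheory

/-! ### The Gaussian cross moment and the cross increments -/

section Vec

variable {Ω : Type*} {mΩ : MeasurableSpace Ω} {P : Measure Ω} {d : ℕ}
  {W : ℝ≥0 → Ω → (Fin d → ℝ)}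

/-- `∫ x_p x_q dN(0, h I) = 0` for `p ≠ q` (product of the centred one-dimensional marginals).
[folklore] -/
theorem gaussVec_integral_mul_of_ne {p q : Fin d} (hpq : p ≠ q) (h : ℝ≥0) :
    ∫ x, x p * x q ∂gaussVec d h = 0 := by
  classical
  set gg : Fin d → ℝ → ℝ := fun k y => if k = p ∨ k = q then y else 1 with hgg
  have hprod : ∀ x : Fin d → ℝ, ∏ k, gg k (x k) = x p * x q := by
    intro x
    rw [← Finset.prod_filter_mul_prod_filter_not Finset.univ (fun k => k = p ∨ k = q)]
    have h2 : (Finset.univ.filter fun k => ¬(k = p ∨ k = q)).prod (fun k => gg k (x k)) = 1 :=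
      Finset.prod_eq_one fun k hk => by
        simp only [Finset.mem_filter, Finset.mem_univ, true_and] at hk
        simp [hgg, hk]
    have h1 : (Finset.univ.filter fun k => k = p ∨ k = q) = {p, q} := by ext k; simp
    rw [h2, mul_one, h1, Finset.prod_pair hpq]
    simp [hgg]
  simp_rw [← hprod]
  rw [gaussVec, integral_fintype_prod_eq_prod]
  have hp : ∫ y, gg p y ∂gaussianReal 0 h = 0 := by simp [hgg, integral_id_gaussianReal]
  exact Finset.prod_eq_zero (Finset.mem_univ p) hp

/-- **Cross increments are uncorrelated**: `E[(W^a_{s+h} - W^a_s)(W^b_{s+h} - W^b_s)] = 0` for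
`a ≠ b`. [folklore] -/
theorem integral_coordIncr_mul_coordIncr [IsProbabilityMeasure P] (hW : IsBrownianVec W P)
    (s h : ℝ≥0) {a b : Fin d} (hab : a ≠ b) :
    ∫ ω, (W (s + h) ω a - W s ω a) * (W (s + h) ω b - W s ω b) ∂P = 0 := by
  have hm : AEMeasurable (fun ω => W (s + h) ω - W s ω) P :=
    ((hW.measurable _).sub (hW.measurable _)).aemeasurable
  have hf : Measurable fun x : Fin d → ℝ => x a * x b :=
    (measurable_pi_apply a).mul (measurable_pi_apply b)
  have := integral_map hm (f := fun x : Fin d → ℝ => x a * x b) hf.aestronglyMeasurable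
  rw [hW.map_incr s h, gaussVec_integral_mul_of_ne hab] at this
  simpa [Pi.sub_apply] using this.symm

/-- **Conditionally uncorrelated cross increments**:
`E[(W^a_{s+h} - W^a_s)(W^b_{s+h} - W^b_s) | 𝓕_s] = 0` a.s. for `a ≠ b` (independence of the
increment VECTOR from the joint past). [folklore] -/
theorem condExp_coordIncr_mul_coordIncr [IsProbabilityMeasure P] (hW : IsBrownianVec W P)
    (s h : ℝ≥0) {a b : Fin d} (hab : a ≠ b) :
    P[fun ω => (W (s + h) ω a - W s ω a) * (W (s + h) ω b - W s ω b) | hW.natFiltration s]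
      =ᵐ[P] 0 := by
  have h1 := IsBrownianVec.measurable_incr_comap (W := W) s h
  have hf : Measurable[MeasurableSpace.comap (vecShift W s) inferInstance]
      (fun ω => (W (s + h) ω a - W s ω a) * (W (s + h) ω b - W s ω b)) := by
    have ha : Measurable[MeasurableSpace.comap (vecShift W s) inferInstance]
        (fun ω => W (s + h) ω a - W s ω a) := (measurable_pi_apply a).comp h1
    have hb : Measurable[MeasurableSpace.comap (vecShift W s) inferInstance]
        (fun ω => W (s + h) ω b - W s ω b) := (measurable_pi_apply b).comp h1
    exact ha.mul hb
  have hc := condExp_indep_eq (m₁ := MeasurableSpace.comap (vecShift W s) inferInstance)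
    (μ := P) (f := fun ω => (W (s + h) ω a - W s ω a) * (W (s + h) ω b - W s ω b))
    (hW.measurable_vecShift s).comap_le (hW.natFiltration.le s) hf.stronglyMeasurable
    (hW.indep_comap_vecShift_natFiltration s)
  refine hc.trans (Eventually.of_forall fun ω => ?_)
  simp only [Pi.zero_apply]
  exact integral_coordIncr_mul_coordIncr hW s h hab

/-- **`W^a W^b` is a martingale for the JOINT raw natural filtration** (`a ≠ b`): zero
cross-variation of different coordinates of a Brownian vector.
`W^a_t W^b_t = W^a_s W^b_s + W^a_s ΔW^b + W^b_s ΔW^a + ΔW^a ΔW^b`; the two middle terms have zero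
conditional expectation (pull-out), and so has the last (`condExp_coordIncr_mul_coordIncr`).
Revuz–Yor, *Continuous Martingales and Brownian Motion* (1999), Ch. IV, Thm (1.9) (the bracket of
independent Brownian motions vanishes); proved here from first principles. [folklore] -/
theorem martingale_coord_mul_coord [IsProbabilityMeasure P] (hW : IsBrownianVec W P) {a b : Fin d}
    (hab : a ≠ b) : Martingale (fun t ω => W t ω a * W t ω b) hW.natFiltration P := by
  refine ⟨fun t => ((stronglyAdapted_coord hW) a t).mul ((stronglyAdapted_coord hW) b t),
    fun s t hst => ?_⟩
  obtain ⟨h, rfl⟩ : ∃ h : ℝ≥0, t = s + h := ⟨t - s, (add_tsub_cancel_of_le hst).symm⟩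
  set Da : Ω → ℝ := fun ω => W (s + h) ω a - W s ω a with hDa
  set Db : Ω → ℝ := fun ω => W (s + h) ω b - W s ω b with hDb
  set A : Ω → ℝ := fun ω => W s ω a with hA
  set Bb : Ω → ℝ := fun ω => W s ω b with hBb
  have hA2 : MemLp A 2 P := (memLp_two_coord hW) s a
  have hB2 : MemLp Bb 2 P := (memLp_two_coord hW) s b
  have hDa2 : MemLp Da 2 P := (memLp_two_coordIncr hW) s h a
  have hDb2 : MemLp Db 2 P := (memLp_two_coordIncr hW) s h b
  have hAB : Integrable (A * Bb) P := hA2.integrable_mul hB2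
  have hADb : Integrable (A * Db) P := hA2.integrable_mul hDb2
  have hBDa : Integrable (Bb * Da) P := hB2.integrable_mul hDa2
  have hDD : Integrable (Da * Db) P := hDa2.integrable_mul hDb2
  have hsA : StronglyMeasurable[hW.natFiltration s] A := (stronglyAdapted_coord hW) a s
  have hsB : StronglyMeasurable[hW.natFiltration s] Bb := (stronglyAdapted_coord hW) b s
  have hdec : (fun ω => W (s + h) ω a * W (s + h) ω b) = A * Bb + A * Db + Bb * Da + Da * Db := by
    ext ω
    simp only [hDa, hDb, hA, hBb, Pi.add_apply, Pi.mul_apply]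
    ring
  have h1 : P[A * Bb | hW.natFiltration s] = A * Bb :=
    condExp_of_stronglyMeasurable (hW.natFiltration.le s) (hsA.mul hsB) hAB
  have h2 : P[A * Db | hW.natFiltration s] =ᵐ[P] 0 := by
    have := condExp_mul_of_stronglyMeasurable_left hsA hADb (hDb2.integrable one_le_two)
      (m := hW.natFiltration s)
    filter_upwards [this, (condExp_coordIncr hW) s h b] with ω hω hω'
    rw [hω, Pi.mul_apply, hω', Pi.zero_apply, mul_zero]
  have h3 : P[Bb * Da | hW.natFiltration s] =ᵐ[P] 0 := by
    have := condExp_mul_of_stronglyMeasurable_left hsB hBDa (hDa2.integrable one_le_two)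
      (m := hW.natFiltration s)
    filter_upwards [this, (condExp_coordIncr hW) s h a] with ω hω hω'
    rw [hω, Pi.mul_apply, hω', Pi.zero_apply, mul_zero]
  have h4 : P[Da * Db | hW.natFiltration s] =ᵐ[P] 0 := condExp_coordIncr_mul_coordIncr hW s h hab
  have hE1 := condExp_add hAB hADb (hW.natFiltration s) (μ := P)
  have hE2 := condExp_add (hAB.add hADb) hBDa (hW.natFiltration s) (μ := P)
  have hE3 := condExp_add ((hAB.add hADb).add hBDa) hDD (hW.natFiltration s) (μ := P)
  show P[fun ω => W (s + h) ω a * W (s + h) ω b | hW.natFiltration s] =ᵐ[P] fun ω => W s ω a * W s ω b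
  rw [hdec]
  filter_upwards [hE1, hE2, hE3, h2, h3, h4] with ω hE1ω hE2ω hE3ω h2ω h3ω h4ω
  rw [hE3ω, Pi.add_apply, hE2ω, Pi.add_apply, hE1ω, Pi.add_apply, h1, h2ω, h3ω, h4ω]
  simp [hA, hBb]

/-- **Covariation of Itô integrals against two different coordinates of a Brownian vector
(joint filtration)**: `E[Z (J_t - J_s)(J'_t - J'_s)] = 0` for `J = ∫ H dW^a`, `J' = ∫ K dW^b`,
`a ≠ b`, `H, K` progressive with `E ∫₀ᵗ H², E ∫₀ᵗ K² < ∞`, `s ≤ t`, `Z` bounded `𝓕_s`-measurable.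
[folklore] -/
theorem integral_itoIntegral_coord_mul_sub_of_ne [IsProbabilityMeasure P] (hW : IsBrownianVec W P)
    {a b : Fin d} (hab : a ≠ b) {H K J J' : ℝ≥0 → Ω → ℝ}
    (hH : IsStronglyProgressive hW.natFiltration H) (hK : IsStronglyProgressive hW.natFiltration K)
    (hHfin : ∀ t : ℝ≥0, sqErr H 0 P t ≠ ⊤) (hKfin : ∀ t : ℝ≥0, sqErr K 0 P t ≠ ⊤)
    (hJ : IsItoIntegral H (fun t ω => W t ω a) J hW.natFiltration P)
    (hJ' : IsItoIntegral K (fun t ω => W t ω b) J' hW.natFiltration P)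
    {s t : ℝ≥0} (hst : s ≤ t) {Z : Ω → ℝ} (hZ : StronglyMeasurable[hW.natFiltration s] Z) {C : ℝ}
    (hC : ∀ ω, |Z ω| ≤ C) :
    ∫ ω, Z ω * ((J t ω - J s ω) * (J' t ω - J' s ω)) ∂P = 0 := by
  have hcov : Martingale (fun t ω => W t ω a * W t ω b - 0 * (t : ℝ)) hW.natFiltration P := by
    simpa using martingale_coord_mul_coord hW hab
  have h := IsItoIntegral.integral_mul_sub_mul_sub (martingale_coord hW a) (martingale_coord_sq_sub hW a)
    (memLp_two_coord hW · a) (continuous_coord hW a) (martingale_coord hW b)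
    (martingale_coord_sq_sub hW b) (memLp_two_coord hW · b) (continuous_coord hW b) hcov hH hK hHfin
    hKfin hJ hJ' hst hZ hC
  simpa using h

/-- **Conditional Itô isometry for integrals against one coordinate of a Brownian vector (joint
filtration)**: `E[Z (J_t - J_s)(J'_t - J'_s)] = E[Z ∫_{(s,t]} H_r K_r dr]` for `J = ∫ H dW^a`,
`J' = ∫ K dW^a`. [folklore] -/
theorem integral_itoIntegral_coord_mul_sub_self [IsProbabilityMeasure P] (hW : IsBrownianVec W P)
    (a : Fin d) {H K J J' : ℝ≥0 → Ω → ℝ}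
    (hH : IsStronglyProgressive hW.natFiltration H) (hK : IsStronglyProgressive hW.natFiltration K)
    (hHfin : ∀ t : ℝ≥0, sqErr H 0 P t ≠ ⊤) (hKfin : ∀ t : ℝ≥0, sqErr K 0 P t ≠ ⊤)
    (hJ : IsItoIntegral H (fun t ω => W t ω a) J hW.natFiltration P)
    (hJ' : IsItoIntegral K (fun t ω => W t ω a) J' hW.natFiltration P)
    {s t : ℝ≥0} (hst : s ≤ t) {Z : Ω → ℝ} (hZ : StronglyMeasurable[hW.natFiltration s] Z) {C : ℝ}
    (hC : ∀ ω, |Z ω| ≤ C) :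
    ∫ ω, Z ω * ((J t ω - J s ω) * (J' t ω - J' s ω)) ∂P =
      ∫ ω, Z ω * (∫ r in Set.Ioc (s : ℝ) t, H r.toNNReal ω * K r.toNNReal ω) ∂P := by
  have hcov : Martingale (fun t ω => W t ω a * W t ω a - 1 * (t : ℝ)) hW.natFiltration P := by
    have heq : (fun t ω => W t ω a * W t ω a - 1 * (t : ℝ)) = fun t ω => (W t ω a) ^ 2 - (t : ℝ) := by
      funext t ω; ring
    rw [heq]; exact martingale_coord_sq_sub hW a
  have h := IsItoIntegral.integral_mul_sub_mul_sub (martingale_coord hW a) (martingale_coord_sq_sub hW a)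
    (memLp_two_coord hW · a) (continuous_coord hW a) (martingale_coord hW a)
    (martingale_coord_sq_sub hW a) (memLp_two_coord hW · a) (continuous_coord hW a) hcov hH hK hHfin
    hKfin hJ hJ' hst hZ hC
  simpa using h

end Vec

/-! ### Flat Brownian motions (the noise of the lattice Langevin dynamics) -/

section Flat

variable {Ω : Type*} {mΩ : MeasurableSpace Ω} {P : Measure Ω} {d L : ℕ} [NeZero L] {κ : Type*}
  [Fintype κ] {W : ℝ≥0 → Ω → (Edge d L × κ → ℝ)}

/-- **`W^i W^j` is a martingale for `hW.natFiltration`** for two different coordinates `i ≠ j` of a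
flat Brownian motion. [folklore] -/
theorem martingale_flatCoord_mul_flatCoord [IsProbabilityMeasure P] (hW : IsFlatBrownian W P)
    {i j : Edge d L × κ} (hij : i ≠ j) :
    Martingale (fun t ω => W t ω i * W t ω j) hW.natFiltration P := by
  rw [natFiltration_flat_eq hW]
  have hij' : Fintype.equivFin (Edge d L × κ) i ≠ Fintype.equivFin (Edge d L × κ) j :=
    fun h => hij ((Fintype.equivFin (Edge d L × κ)).injective h)
  have h := martingale_coord_mul_coord hW hij'
  simp only [Equiv.symm_apply_apply] at h
  exact h

/-- **Covariation of Itô integrals against two different coordinates of a flat Brownian motion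
(joint filtration)**: `E[Z (J_t - J_s)(J'_t - J'_s)] = 0`, `J = ∫ H dW^i`, `J' = ∫ K dW^j`, `i ≠ j`.
[folklore] -/
theorem integral_itoIntegral_flatCoord_mul_sub_of_ne [IsProbabilityMeasure P] (hW : IsFlatBrownian W P)
    {i j : Edge d L × κ} (hij : i ≠ j) {H K J J' : ℝ≥0 → Ω → ℝ}
    (hH : IsStronglyProgressive hW.natFiltration H) (hK : IsStronglyProgressive hW.natFiltration K)
    (hHfin : ∀ t : ℝ≥0, sqErr H 0 P t ≠ ⊤) (hKfin : ∀ t : ℝ≥0, sqErr K 0 P t ≠ ⊤)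
    (hJ : IsItoIntegral H (fun t ω => W t ω i) J hW.natFiltration P)
    (hJ' : IsItoIntegral K (fun t ω => W t ω j) J' hW.natFiltration P)
    {s t : ℝ≥0} (hst : s ≤ t) {Z : Ω → ℝ} (hZ : StronglyMeasurable[hW.natFiltration s] Z) {C : ℝ}
    (hC : ∀ ω, |Z ω| ≤ C) :
    ∫ ω, Z ω * ((J t ω - J s ω) * (J' t ω - J' s ω)) ∂P = 0 := by
  have hcov : Martingale (fun t ω => W t ω i * W t ω j - 0 * (t : ℝ)) hW.natFiltration P := by
    simpa using martingale_flatCoord_mul_flatCoord hW hij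
  have h := IsItoIntegral.integral_mul_sub_mul_sub (martingale_flatCoord hW i)
    (martingale_flatCoord_sq_sub hW i) (fun t => memLp_two_flatCoord hW t i) (continuous_flatCoord hW i)
    (martingale_flatCoord hW j) (martingale_flatCoord_sq_sub hW j) (fun t => memLp_two_flatCoord hW t j)
    (continuous_flatCoord hW j) hcov hH hK hHfin hKfin hJ hJ' hst hZ hC
  simpa using h

/-- **Conditional Itô isometry against one coordinate of a flat Brownian motion (joint
filtration)**: `E[Z (J_t - J_s)(J'_t - J'_s)] = E[Z ∫_{(s,t]} H_r K_r dr]`, `J = ∫ H dW^i`,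
`J' = ∫ K dW^i`. [folklore] -/
theorem integral_itoIntegral_flatCoord_mul_sub_self [IsProbabilityMeasure P] (hW : IsFlatBrownian W P)
    (i : Edge d L × κ) {H K J J' : ℝ≥0 → Ω → ℝ}
    (hH : IsStronglyProgressive hW.natFiltration H) (hK : IsStronglyProgressive hW.natFiltration K)
    (hHfin : ∀ t : ℝ≥0, sqErr H 0 P t ≠ ⊤) (hKfin : ∀ t : ℝ≥0, sqErr K 0 P t ≠ ⊤)
    (hJ : IsItoIntegral H (fun t ω => W t ω i) J hW.natFiltration P)
    (hJ' : IsItoIntegral K (fun t ω => W t ω i) J' hW.natFiltration P)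
    {s t : ℝ≥0} (hst : s ≤ t) {Z : Ω → ℝ} (hZ : StronglyMeasurable[hW.natFiltration s] Z) {C : ℝ}
    (hC : ∀ ω, |Z ω| ≤ C) :
    ∫ ω, Z ω * ((J t ω - J s ω) * (J' t ω - J' s ω)) ∂P =
      ∫ ω, Z ω * (∫ r in Set.Ioc (s : ℝ) t, H r.toNNReal ω * K r.toNNReal ω) ∂P := by
  have hcov : Martingale (fun t ω => W t ω i * W t ω i - 1 * (t : ℝ)) hW.natFiltration P := by
    have heq : (fun t ω => W t ω i * W t ω i - 1 * (t : ℝ)) = fun t ω => (W t ω i) ^ 2 - (t : ℝ) := by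
      funext t ω; ring
    rw [heq]; exact martingale_flatCoord_sq_sub hW i
  have h := IsItoIntegral.integral_mul_sub_mul_sub (martingale_flatCoord hW i)
    (martingale_flatCoord_sq_sub hW i) (fun t => memLp_two_flatCoord hW t i) (continuous_flatCoord hW i)
    (martingale_flatCoord hW i) (martingale_flatCoord_sq_sub hW i) (fun t => memLp_two_flatCoord hW t i)
    (continuous_flatCoord hW i) hcov hH hK hHfin hKfin hJ hJ' hst hZ hC
  simpa using h

end Flat

end Summit.QuantumFields.YangMills.Theorems.ColdStartUniversality

end
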